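import Summits.QuantumFields.YangMills.Theorems.BalabanUVNodesN22TermPolarizationLocalCauchy
import Summits.QuantumFields.YangMills.Theorems.BalabanUVNodesN22WindowSoftTwoPointDomSys
import Summits.QuantumFields.YangMills.Theorems.BalabanUVNodesN22KernelLimitOfLocalTerms

/-!
# NODE N22 (NE9) — THE (1.21)-EXISTENCE SCHEMA ON THE SOFT ROAD: approximate cross-volume stability of the small-domain partial sums + GEOMETRIC volume-feeling
# tails from dag-n22-w2's soft majorants with a threshold («this limit exists by the localized representation (1.7)», [I] p. 264)

Cell `pub-ymgap`, Track A (HUMAN RULING D-0062), WIDTH SEAT `dag-n22-w3` g3 on node n22 = NE9; `--kind proof --supports stmt-QuantumFields-20544 --as helper` (K3⁷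
`SpineGivenEndpointR13SepCoPH`, skeleton v5 941dddb108cbaacf), COUNT-NEUTRAL.  First of the two files of this seat's CLAIM-2 (pub-ymgap INBOX l.28776; dag-lead DEDUP-380 (1)
l.28826 «GO»): the EXISTENCE HALF of the row-n22 lever in this seat's own lane (g2 chain `…N22AtU3OfKernelsLimitExistence` p595960 → `…N22KernelLimitOfLocalTerms` p597055); the sequel
`…N22KernelLimitOfActivitySlots` instantiates it at W1-20's localized sum from W1's ACTIVITY-LEVEL value slot.

WHY (print).  [I] p. 264: «Now we take a limit of these functions as T^{(j+1)} ↗ Z^d. This limit exists by the localized representation (1.7)» — the terms whose domains do not feel the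
volume converge, the volume-feeling ones are exponentially few ((1.18) + the tree-length resummation, uniform in the volume).  dag-n22-w3 g2 typed the schema with EXACT stability of the
small-domain partial sums (`polLimitExists_sum_of_stable_tail`, p597055) — the HARD-road reading.  On the SOFT road of record (dag-n22-w2's located reason, INBOX l.26814: the probe enters
through the minimizer `U_{k+1}(exp iB)`, non-locally, with the tails of [I] p. 282) exact cross-volume equality is not available; what survives is APPROXIMATE stability with a geometric
error, and the tails come from the same soft majorants that feed the (5.10) resummation.

* §0 real arithmetic: `exp_threshold_split` (if `T ≤ d ∨ T ≤ D` then `e^{−κd}e^{−δD} ≤ e^{−min(κ,δ)T∕2}·e^{−κd∕2}e^{−δD∕2}`); `abs_sum_sub_sum_le_of_approxStable` (two finite sums with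
  `σ`-close «small» parts differ by `≤ σ + τ + τ′`).
* §1 `abs_polScalar_le_of_holomorphic_weighted` — the per-term SOFT VALUE bound of def-B's scalar kernel `|Π^{cc}(x,y)| ≤ 16 M r⁻² w(x) w(y)` from a bounded holomorphic complexification
  with site weights (dag-n22-c J28 `abs_polTensor_le_of_holomorphic` p596444, averaged over the colour basis as in J29-v1.1).
* §2 ★ `polLimitExists_sum_of_approxStable_tail` — the (1.21)-existence SCHEMA, approximate edition: (C²) charts + (S≈) `C₀r₀^K`-close small partial sums + (T) tails `≤ C₁r₁^K` in both
  volumes ⇒ geometric volume-increments ⇒ def-B's `PolLimitExists` (this seat's g2 `polLimitExists_of_eventually_geometric_increments`, p595960; J27 `polScalar_finset_sum`, p594958).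
* §3 ★★ `exists_tail_le_geometric_of_softMajorant` — THE ONE NEW ESTIMATE (elementary): per-term quantities with dag-n22-w2's SOFT MAJORANTS
  `≤ C_E·w·e^{−κd_j(X)}·e^{−δ₀dist(cast site z, X)}·e^{−δ₀dist(cast site 0, X)}` and a «small» class whose complement FEELS THE VOLUME (`K ≤ d_j(X) ∨ K ≤ dist(cast site 0, X)`) have tails
  `Σ_{X ∉ lo K} ≤ C·q^K`, `q = e^{−min(κ,δ₀)∕2} < 1` — `exp_threshold_split` pulls `q^K` out of each volume-feeling term, dag-n22-w2's cast-torus (5.10) resummation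
  `eventually_le_of_softSum_domSys` (p599486) resums the rest at the HALVED rates (`κ₀(64,8) ≤ κ∕4`).

HONEST FRAMING (binding).  Count-neutral bookkeeping (finite sums, triangle inequality, one `exp` split) over LANDED theorems cited by name; THEOREMS ONLY (0 def, 0 sorry, standard axioms).
The stability law (S≈) and the soft majorants are DISPLAYED HYPOTHESES (NODE A ∕ N10 ∕ def-W1 content); nothing of Bałaban's is asserted or constructed; (1.21)'s existence for the terms
OF RECORD is NOT proved here; N22 NOT discharged; K3⁷ OPEN, NOT claimed; no count claim (the chair's single count line is the only count); one finite 𝕋⁴ programme at fixed ε — R4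
closes the CONDITIONAL rung `BalabanLadder.UV` only; NOTHING about the continuum limit, ℝ⁴, OS axioms, a mass gap or the Clay problem is proved or claimed.  No cite tags (Summit side);
TYPES only: [I] = [Balaban1987RG1] (1.7) p. 261, (1.18) p. 263, (1.20)–(1.21) p. 264, p. 282, (5.10) p. 293.
-/

noncomputable section

open Filter Topology Metric Set
open scoped BigOperators

namespace YMDAG.N22.AtKernels

open Literature.MathematicalPhysics.QuantumFieldTheory.Balaban1983to89
open Literature.MathematicalPhysics.QuantumFieldTheory.Balaban1983to89.T4Continuum (T4Family)
open Literature.MathematicalPhysics.QuantumFieldTheory.Balaban1983to89.T4OutputRate (Window)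
open Literature.MathematicalPhysics.QuantumFieldTheory.Balaban1983to89.B12PolarizationTensor120 (polTensor polComp expChart)
open Literature.MathematicalPhysics.QuantumFieldTheory.Balaban1983to89.Node00 (polScalar polWindow siteOfInt PolLimitExists Stage13Params MatA)
open Literature.MathematicalPhysics.QuantumFieldTheory.Balaban1983to89.Node00.Sect2 (domCount domSys CPair)
open Literature.MathematicalPhysics.QuantumFieldTheory.Balaban1983to89.Node00.W1 (ClusterTower ClusterStep)
open Literature.MathematicalPhysics.QuantumFieldTheory.Balaban1983to89.Node00.LocalizedSum17 (localizedSum ReadingMaps Localizes17OfRecord₁₃)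
open Literature.MathematicalPhysics.QuantumFieldTheory.Balaban1983to89.Node00.U3OfKernels (histPrefix)
open Literature.MathematicalPhysics.QuantumFieldTheory.Balaban1983to89.Node00.U3KernelLetters (PolLimitsExist PolLimitsExistOfRecord₁₃ polLimitsExistOfRecord₁₃_iff_of_localizes)
open Literature.MathematicalPhysics.QuantumFieldTheory.Balaban1983to89.B12Decay510 (delta1)
open Literature.MathematicalPhysics.QuantumFieldTheory.Balaban1983to89.B12Decay510Window (K₁)
open Literature.MathematicalPhysics.QuantumFieldTheory.Balaban1983to89.B12Decay510Torus (distCT nearT distCT_nonneg)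
open Literature.MathematicalPhysics.QuantumFieldTheory.Balaban1983to89.B12TreeDecay (K₀ kappa₀ K₀_pos kappa₀_nonneg)
open Literature.MathematicalPhysics.QuantumFieldTheory.Balaban1983to89.TreeLengthTorus (TPt torusTreeLen torusTreeLen_nonneg)
open YMDAG.N22.WindowOfLocalTerms (contDiffAt_two_of_holomorphic abs_polTensor_le_of_holomorphic)
open YMDAG.N22.WindowSoftTwoPoint (eventually_le_of_softSum_domSys)

/-! ## §0 Real arithmetic: the threshold split of the decay factors; finite sums with approximately stable small parts -/

/-- **THRESHOLD SPLIT.**  If one of two nonnegative «distances» `d, D` is at least `T`, the product of decay factors `e^{−κd}·e^{−δD}` (`κ, δ ≥ 0`) is at most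
`e^{−(min κ δ)·T∕2}` times the same product at HALVED rates. -/
theorem exp_threshold_split {κ δ d D T : ℝ} (hκ : 0 ≤ κ) (hδ : 0 ≤ δ) (hd : 0 ≤ d) (hD : 0 ≤ D) (h : T ≤ d ∨ T ≤ D) :
    Real.exp (-(κ * d)) * Real.exp (-(δ * D)) ≤ Real.exp (-(min κ δ * T / 2)) * (Real.exp (-(κ / 2 * d)) * Real.exp (-(δ / 2 * D))) := by
  have eκ : Real.exp (-(κ * d)) = Real.exp (-(κ / 2 * d)) * Real.exp (-(κ / 2 * d)) := by rw [← Real.exp_add]; ring_nf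
  have eδ : Real.exp (-(δ * D)) = Real.exp (-(δ / 2 * D)) * Real.exp (-(δ / 2 * D)) := by rw [← Real.exp_add]; ring_nf
  have hκ1 : Real.exp (-(κ / 2 * d)) ≤ 1 := Real.exp_le_one_iff.2 (by nlinarith)
  have hδ1 : Real.exp (-(δ / 2 * D)) ≤ 1 := Real.exp_le_one_iff.2 (by nlinarith)
  rcases h with h | h
  · -- `d ≥ T`: the first factor carries the smallness
    have hs : Real.exp (-(κ / 2 * d)) ≤ Real.exp (-(min κ δ * T / 2)) := by
      refine Real.exp_le_exp.2 (neg_le_neg ?_)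
      have : min κ δ * T ≤ κ * d := by
        rcases le_or_gt 0 T with hT | hT
        · exact mul_le_mul (min_le_left _ _) h hT hκ
        · exact (mul_nonpos_iff.2 (Or.inl ⟨le_min hκ hδ, hT.le⟩)).trans (mul_nonneg hκ hd)
      linarith
    calc Real.exp (-(κ * d)) * Real.exp (-(δ * D))
        = Real.exp (-(κ / 2 * d)) * (Real.exp (-(κ / 2 * d)) * Real.exp (-(δ * D))) := by rw [eκ, mul_assoc]
      _ ≤ Real.exp (-(min κ δ * T / 2)) * (Real.exp (-(κ / 2 * d)) * Real.exp (-(δ / 2 * D))) := by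
          refine mul_le_mul hs (mul_le_mul_of_nonneg_left ?_ (Real.exp_nonneg _)) (by positivity) (Real.exp_nonneg _)
          rw [eδ]; exact mul_le_of_le_one_left (Real.exp_nonneg _) hδ1
  · -- `D ≥ T`: the second factor carries the smallness
    have hs : Real.exp (-(δ / 2 * D)) ≤ Real.exp (-(min κ δ * T / 2)) := by
      refine Real.exp_le_exp.2 (neg_le_neg ?_)
      have : min κ δ * T ≤ δ * D := by
        rcases le_or_gt 0 T with hT | hT
        · exact mul_le_mul (min_le_right _ _) h hT hδ
        · exact (mul_nonpos_iff.2 (Or.inl ⟨le_min hκ hδ, hT.le⟩)).trans (mul_nonneg hδ hD)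
      linarith
    calc Real.exp (-(κ * d)) * Real.exp (-(δ * D))
        = Real.exp (-(δ / 2 * D)) * (Real.exp (-(κ * d)) * Real.exp (-(δ / 2 * D))) := by rw [eδ]; ring
      _ ≤ Real.exp (-(min κ δ * T / 2)) * (Real.exp (-(κ / 2 * d)) * Real.exp (-(δ / 2 * D))) := by
          refine mul_le_mul hs (mul_le_mul_of_nonneg_right ?_ (Real.exp_nonneg _)) (by positivity) (Real.exp_nonneg _)
          rw [eκ]; exact mul_le_of_le_one_left (Real.exp_nonneg _) hκ1

/-- Two finite sums over possibly different index types whose «small» partial sums are `σ`-CLOSE differ by at most `σ` plus the two «large» absolute tails (the approximate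
edition of `abs_sum_sub_sum_le_of_stable`). -/
theorem abs_sum_sub_sum_le_of_approxStable {α β : Type*} (s : Finset α) (s' : Finset β) (a : α → ℝ) (b : β → ℝ) (p : α → Prop) (q : β → Prop)
    [DecidablePred p] [DecidablePred q] {σ τ τ' : ℝ} (hstab : |∑ y ∈ s'.filter q, b y - ∑ x ∈ s.filter p, a x| ≤ σ)
    (hτ : ∑ x ∈ s.filter (fun x => ¬ p x), |a x| ≤ τ) (hτ' : ∑ y ∈ s'.filter (fun y => ¬ q y), |b y| ≤ τ') :
    |∑ y ∈ s', b y - ∑ x ∈ s, a x| ≤ σ + τ + τ' := by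
  rw [← Finset.sum_filter_add_sum_filter_not s' q, ← Finset.sum_filter_add_sum_filter_not s p]
  have e : (∑ y ∈ s'.filter q, b y + ∑ y ∈ s'.filter (fun y => ¬ q y), b y) - (∑ x ∈ s.filter p, a x + ∑ x ∈ s.filter (fun x => ¬ p x), a x) =
      (∑ y ∈ s'.filter q, b y - ∑ x ∈ s.filter p, a x) + ∑ y ∈ s'.filter (fun y => ¬ q y), b y - ∑ x ∈ s.filter (fun x => ¬ p x), a x := by ring
  rw [e]
  have h1 := Finset.abs_sum_le_sum_abs (fun y => b y) (s'.filter (fun y => ¬ q y))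
  have h2 := Finset.abs_sum_le_sum_abs (fun x => a x) (s.filter (fun x => ¬ p x))
  calc |(∑ y ∈ s'.filter q, b y - ∑ x ∈ s.filter p, a x) + ∑ y ∈ s'.filter (fun y => ¬ q y), b y - ∑ x ∈ s.filter (fun x => ¬ p x), a x|
      ≤ |(∑ y ∈ s'.filter q, b y - ∑ x ∈ s.filter p, a x) + ∑ y ∈ s'.filter (fun y => ¬ q y), b y| + |∑ x ∈ s.filter (fun x => ¬ p x), a x| := abs_sub _ _
    _ ≤ |∑ y ∈ s'.filter q, b y - ∑ x ∈ s.filter p, a x| + |∑ y ∈ s'.filter (fun y => ¬ q y), b y| + |∑ x ∈ s.filter (fun x => ¬ p x), a x| := by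
        gcongr; exact abs_add_le _ _
    _ ≤ σ + τ' + τ := by gcongr; exacts [h1.trans hτ', h2.trans hτ]
    _ = σ + τ + τ' := by ring

/-! ## §1 The per-term VALUE bound of def-B's scalar kernel from a bounded holomorphic complexification with site weights (J28's Cauchy bound, averaged over colours) -/

section PerTerm

variable {Λ T : Type*} [Fintype Λ] [Fintype T] [DecidableEq Λ] [DecidableEq T]
variable {V : Type*} [NormedAddCommGroup V] [NormedSpace ℝ V] {ι' : Type*} [Fintype ι']
variable {𝔄 : Type*} [NormedRing 𝔄] [NormedAlgebra ℝ 𝔄] {Ec : Type*} [NormedAddCommGroup Ec] [NormedSpace ℂ Ec]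

/-- **PER-TERM SOFT VALUE BOUND.**  If the exponential chart of a term functional `ℰ` is the real part of `G ∘ ι` with `G` holomorphic on an open `U ⊇ ball 0 r`, `‖G‖ ≤ M` there, and
the one-site colour directions of `ι` carry site weights `‖ι e_{l,t,c}‖ ≤ w t`, then def-B's scalar kernel obeys `|Π^{cc}(x, y)| ≤ 16 M r⁻² · w x · w y` (dag-n22-c J28
`abs_polTensor_le_of_holomorphic`, averaged over the colour basis). -/
theorem abs_polScalar_le_of_holomorphic_weighted (ℰ : (Λ → T → 𝔄) → ℝ) (ρ : V →L[ℝ] 𝔄) (bV : Module.Basis ι' ℝ V)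
    (G : Ec → ℂ) {U : Set Ec} (hG : DifferentiableOn ℂ G U) (hU : IsOpen U) {r M : ℝ} (hr : 0 < r) (hrU : ball (0 : Ec) r ⊆ U)
    (hM : ∀ z ∈ ball (0 : Ec) r, ‖G z‖ ≤ M) (ι : (Λ → T → V) →L[ℝ] Ec) (hf : ∀ B, expChart ℰ ρ B = (G (ι B)).re)
    (w : T → ℝ) (hw₀ : ∀ t, 0 ≤ w t) (hw : ∀ (l : Λ) (t : T) (c : ι'), ‖ι (Pi.single l (Pi.single t (bV c)))‖ ≤ w t)
    (μ : Λ) (x : T) (ν : Λ) (y : T) :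
    |polScalar ℰ ρ bV μ x ν y| ≤ 16 * M / r ^ 2 * (w x * w y) := by
  have hM0 : 0 ≤ M := (norm_nonneg _).trans (hM 0 (mem_ball_self hr))
  set S : ℝ := 16 * M / r ^ 2 * (w x * w y) with hS
  have hS0 : 0 ≤ S := by have := hw₀ x; have := hw₀ y; positivity
  have hc : ∀ c : ι', |polComp ℝ (expChart ℰ ρ) bV μ x c ν y c| ≤ S := by
    intro c
    simp only [polComp]
    have h16 : 0 ≤ 16 * M / r ^ 2 := by positivity
    calc |polTensor ℝ (expChart ℰ ρ) μ x (bV c) ν y (bV c)|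
        ≤ 16 * M / r ^ 2 * ‖ι (Pi.single μ (Pi.single x (bV c)))‖ * ‖ι (Pi.single ν (Pi.single y (bV c)))‖ :=
          abs_polTensor_le_of_holomorphic G hG hU hr hrU hM ι _ hf μ x (bV c) ν y (bV c)
      _ ≤ 16 * M / r ^ 2 * w x * w y := mul_le_mul (mul_le_mul_of_nonneg_left (hw μ x c) h16) (hw ν y c) (norm_nonneg _) (mul_nonneg h16 (hw₀ x))
      _ = S := by rw [hS]; ring
  simp only [polScalar, abs_mul, abs_inv, Nat.abs_cast]
  by_cases hι : Fintype.card ι' = 0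
  · rw [hι]; simp [hS0]
  · have hpos : (0 : ℝ) < Fintype.card ι' := Nat.cast_pos.2 (Nat.pos_of_ne_zero hι)
    calc (Fintype.card ι' : ℝ)⁻¹ * |∑ c, polComp ℝ (expChart ℰ ρ) bV μ x c ν y c|
        ≤ (Fintype.card ι' : ℝ)⁻¹ * ∑ c : ι', S :=
          mul_le_mul_of_nonneg_left ((Finset.abs_sum_le_sum_abs _ _).trans (Finset.sum_le_sum fun c _ => hc c)) (inv_nonneg.2 hpos.le)
      _ = S := by rw [Finset.sum_const, Finset.card_univ, nsmul_eq_mul, ← mul_assoc, inv_mul_cancel₀ hpos.ne', one_mul]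

end PerTerm

/-! ## §2 Existence of the (1.21) limit of a `K`-indexed family of localized sums from (C²) + APPROXIMATE stability (S≈) + geometric tails (T) -/

section Limit

variable {𝔄 : Type*} [NormedRing 𝔄] [NormedAlgebra ℝ 𝔄] {V : Type*} [NormedAddCommGroup V] [NormedSpace ℝ V] {ι : Type*} [Fintype ι]
variable (F : T4Family) (j : ℕ) (ρ : V →L[ℝ] 𝔄) (bV : Module.Basis ι ℝ V)

/-- ★ **«THIS LIMIT EXISTS BY THE LOCALIZED REPRESENTATION (1.7)» — SCHEMA, APPROXIMATE EDITION** of dag-n22-w3's `polLimitExists_sum_of_stable_tail` (p597055): a `K`-indexed family of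
localized sums `Σ_{X ∈ s K} ℰ K X` on the tori `T^{(j)}_K` with (C²) every exponential chart twice continuously differentiable at `0`; (S≈) for each kernel entry `(μ, ν, z)`, from a threshold
on, the partial sums of the per-term scalar kernels over the «small» terms (`lo K` in volume `K`, `hi K` in volume `K + 1`) are `C₀ r₀^K`-CLOSE across consecutive volumes (thermodynamic
convergence near the window — on the soft road the terms read the probe through the minimizer, so EXACT stability is not available); (T) the complementary absolute tails in both volumes are
`≤ C₁ r₁^K`; `r₀, r₁ < 1`, `0 ≤ r₀, r₁` — has geometric volume-increments, hence def-B's `PolLimitExists F j (fun K U => Σ_{X ∈ s K} ℰ K X U) ρ bV`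
(dag-n22-w3 `polLimitExists_of_eventually_geometric_increments`, p595960).  Every analytic input displayed. -/
theorem polLimitExists_sum_of_approxStable_tail (𝒳 : ℕ → Type*) (s : (K : ℕ) → Finset (𝒳 K))
    (ℰ : (K : ℕ) → 𝒳 K → (Fin (F.P K).d → Site (F.P K) j → 𝔄) → ℝ) (hℰ : ∀ (K : ℕ), ∀ X ∈ s K, ContDiffAt ℝ 2 (expChart (ℰ K X) ρ) 0)
    (lo : (K : ℕ) → 𝒳 K → Prop) (hi : (K : ℕ) → 𝒳 (K + 1) → Prop) [∀ K, DecidablePred (lo K)] [∀ K, DecidablePred (hi K)]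
    {r₀ r₁ : ℝ} (hr₀ : r₀ < 1) (hr₀' : 0 ≤ r₀) (hr₁ : r₁ < 1) (hr₁' : 0 ≤ r₁)
    (hS : ∀ (μ ν : Fin 4) (z : Fin 4 → ℤ), ∃ (K₀ : ℕ) (C : ℝ), ∀ K : ℕ, K₀ ≤ K →
      |∑ X ∈ (s (K + 1)).filter (hi K),
            polScalar (ℰ (K + 1) X) ρ bV (Fin.cast (F.P_d (K + 1)).symm μ) (siteOfInt F (K + 1) j z) (Fin.cast (F.P_d (K + 1)).symm ν) (siteOfInt F (K + 1) j 0) -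
          ∑ X ∈ (s K).filter (lo K), polScalar (ℰ K X) ρ bV (Fin.cast (F.P_d K).symm μ) (siteOfInt F K j z) (Fin.cast (F.P_d K).symm ν) (siteOfInt F K j 0)| ≤
        C * r₀ ^ K)
    (hT : ∀ (μ ν : Fin 4) (z : Fin 4 → ℤ), ∃ (K₀ : ℕ) (C : ℝ), ∀ K : ℕ, K₀ ≤ K →
      ∑ X ∈ (s K).filter (fun X => ¬ lo K X),
          |polScalar (ℰ K X) ρ bV (Fin.cast (F.P_d K).symm μ) (siteOfInt F K j z) (Fin.cast (F.P_d K).symm ν) (siteOfInt F K j 0)| ≤ C * r₁ ^ K)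
    (hT' : ∀ (μ ν : Fin 4) (z : Fin 4 → ℤ), ∃ (K₀ : ℕ) (C : ℝ), ∀ K : ℕ, K₀ ≤ K →
      ∑ X ∈ (s (K + 1)).filter (fun X => ¬ hi K X),
          |polScalar (ℰ (K + 1) X) ρ bV (Fin.cast (F.P_d (K + 1)).symm μ) (siteOfInt F (K + 1) j z) (Fin.cast (F.P_d (K + 1)).symm ν) (siteOfInt F (K + 1) j 0)| ≤
        C * r₁ ^ K) :
    PolLimitExists F j (fun K U => ∑ X ∈ s K, ℰ K X U) ρ bV := by
  have hmax : max r₀ r₁ < 1 := max_lt hr₀ hr₁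
  refine polLimitExists_of_eventually_geometric_increments F j (fun K U => ∑ X ∈ s K, ℰ K X U) ρ bV hmax fun μ ν z => ?_
  obtain ⟨K₀, C₀, h₀⟩ := hS μ ν z
  obtain ⟨K₁, C₁, h₁⟩ := hT μ ν z
  obtain ⟨K₂, C₂, h₂⟩ := hT' μ ν z
  refine ⟨max K₀ (max K₁ K₂), |C₀| + |C₁| + |C₂|, fun K hK => ?_⟩
  have hK₀ : K₀ ≤ K := (le_max_left _ _).trans hK
  have hK₁ : K₁ ≤ K := ((le_max_left _ _).trans (le_max_right _ _)).trans hK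
  have hK₂ : K₂ ≤ K := ((le_max_right _ _).trans (le_max_right _ _)).trans hK
  have key := abs_sum_sub_sum_le_of_approxStable (s K) (s (K + 1))
    (fun X => polScalar (ℰ K X) ρ bV (Fin.cast (F.P_d K).symm μ) (siteOfInt F K j z) (Fin.cast (F.P_d K).symm ν) (siteOfInt F K j 0))
    (fun X => polScalar (ℰ (K + 1) X) ρ bV (Fin.cast (F.P_d (K + 1)).symm μ) (siteOfInt F (K + 1) j z) (Fin.cast (F.P_d (K + 1)).symm ν) (siteOfInt F (K + 1) j 0))
    (lo K) (hi K) (h₀ K hK₀) (h₁ K hK₁) (h₂ K hK₂)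
  have e : polWindow F (K + 1) j (fun U => ∑ X ∈ s (K + 1), ℰ (K + 1) X U) ρ bV μ ν z - polWindow F K j (fun U => ∑ X ∈ s K, ℰ K X U) ρ bV μ ν z =
      ∑ X ∈ s (K + 1), polScalar (ℰ (K + 1) X) ρ bV (Fin.cast (F.P_d (K + 1)).symm μ) (siteOfInt F (K + 1) j z) (Fin.cast (F.P_d (K + 1)).symm ν) (siteOfInt F (K + 1) j 0) -
        ∑ X ∈ s K, polScalar (ℰ K X) ρ bV (Fin.cast (F.P_d K).symm μ) (siteOfInt F K j z) (Fin.cast (F.P_d K).symm ν) (siteOfInt F K j 0) := by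
    simp only [polWindow, YMDAG.N22.WindowOfLocalTerms.polScalar_finset_sum (s K) (ℰ K) ρ bV (hℰ K),
      YMDAG.N22.WindowOfLocalTerms.polScalar_finset_sum (s (K + 1)) (ℰ (K + 1)) ρ bV (hℰ (K + 1))]
  rw [e]
  refine key.trans ?_
  -- `C₀ r₀^K + C₁ r₁^K + C₂ r₁^K ≤ (|C₀| + |C₁| + |C₂|) (max r₀ r₁)^K`
  have hm0 : 0 ≤ max r₀ r₁ := hr₀'.trans (le_max_left _ _)
  have p0 : r₀ ^ K ≤ max r₀ r₁ ^ K := pow_le_pow_left₀ hr₀' (le_max_left _ _) K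
  have p1 : r₁ ^ K ≤ max r₀ r₁ ^ K := pow_le_pow_left₀ hr₁' (le_max_right _ _) K
  have q0 : C₀ * r₀ ^ K ≤ |C₀| * max r₀ r₁ ^ K := (mul_le_mul_of_nonneg_right (le_abs_self _) (pow_nonneg hr₀' _)).trans (mul_le_mul_of_nonneg_left p0 (abs_nonneg _))
  have q1 : C₁ * r₁ ^ K ≤ |C₁| * max r₀ r₁ ^ K := (mul_le_mul_of_nonneg_right (le_abs_self _) (pow_nonneg hr₁' _)).trans (mul_le_mul_of_nonneg_left p1 (abs_nonneg _))
  have q2 : C₂ * r₁ ^ K ≤ |C₂| * max r₀ r₁ ^ K := (mul_le_mul_of_nonneg_right (le_abs_self _) (pow_nonneg hr₁' _)).trans (mul_le_mul_of_nonneg_left p1 (abs_nonneg _))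
  linarith

end Limit

/-! ## §3 THE VOLUME-FEELING TAIL IS GEOMETRICALLY SMALL: soft majorants with p. 282 tails + a threshold `K ≤ d_j(X) ∨ K ≤ dist(site 0, X)` (dag-n22-w2's cast-torus (5.10)
resummation `eventually_le_of_softSum_domSys` at HALVED rates, BY NAME) -/

section Tail

variable (F : T4Family) (j : ℕ)

/-- ★ **THRESHOLDED SOFT RESUMMATION.**  Nonnegative per-term quantities `t K X` over def-T's catalogue of the `K`-th torus (of record: `|Π^{cc}_X|` at the window sites) with SOFT MAJORANTS
`t K X ≤ C_E·w·e^{−κ d_j(X)}·e^{−δ₀ dist(cast site z, X)}·e^{−δ₀ dist(cast site 0, X)}` (constants uniform in `K, X`; `M = L^{m′}`, `κ > 0`, `δ₀ > 0`, `κ₀(64,8) ≤ κ∕4`), and a «small»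
class `lo K` whose complement is VOLUME-FEELING — `¬ lo K X ⇒ K ≤ d_j(X) ∨ K ≤ dist(cast site 0, X)` —: the tail `Σ_{X ∉ lo K} t K X` is eventually `≤ C·q^K` with `q = e^{−min(κ,δ₀)∕2} < 1`
(`exp_threshold_split` pulls `q^K` out of each volume-feeling term; dag-n22-w2's `eventually_le_of_softSum_domSys` resums the rest at the halved rates `κ∕2`, `δ₀∕2`). -/
theorem exists_tail_le_geometric_of_softMajorant (m' : ℕ) (M : ℕ) [NeZero M] (hM : M = F.L ^ m')
    (t : (K : ℕ) → (domSys (F.P K) M j).Dom → ℝ) (lo : (K : ℕ) → (domSys (F.P K) M j).Dom → Prop) [∀ K, DecidablePred (lo K)]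
    {CE w κ δ₀ : ℝ} (hCE : 0 ≤ CE) (hw : 0 ≤ w) (hκ0 : 0 < κ) (hδ₀ : 0 < δ₀) (hκ4 : kappa₀ (4 * 2 ^ 4) (2 * 4) ≤ κ / 2 / 2) (z : Fin 4 → ℤ)
    (ht : ∀ (K : ℕ) (X : (domSys (F.P K) M j).Dom),
      let e : Site (F.P K) j → TPt 4 (domCount (F.P K) M j * M) := fun x i => (ZMod.cast (x i) : ZMod (domCount (F.P K) M j * M))
      t K X ≤ CE * w * Real.exp (-κ * torusTreeLen X.1) *
          Real.exp (-δ₀ * distCT (domCount (F.P K) M j) M (e (siteOfInt F K j z)) (nearT (M := M) (e (siteOfInt F K j z)) X)) *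
          Real.exp (-δ₀ * distCT (domCount (F.P K) M j) M (e (siteOfInt F K j 0)) (nearT (M := M) (e (siteOfInt F K j 0)) X)))
    (hlo : ∀ (K : ℕ) (X : (domSys (F.P K) M j).Dom), ¬ lo K X →
      let e : Site (F.P K) j → TPt 4 (domCount (F.P K) M j * M) := fun x i => (ZMod.cast (x i) : ZMod (domCount (F.P K) M j * M))
      (K : ℝ) ≤ torusTreeLen X.1 ∨ (K : ℝ) ≤ distCT (domCount (F.P K) M j) M (e (siteOfInt F K j 0)) (nearT (M := M) (e (siteOfInt F K j 0)) X)) :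
    ∃ (K₀ : ℕ) (C : ℝ), 0 ≤ C ∧ ∀ K : ℕ, K₀ ≤ K →
      ∑ X ∈ Finset.univ.filter (fun X => ¬ lo K X), t K X ≤ C * Real.exp (-(min κ δ₀ / 2)) ^ K := by
  classical
  set q : ℝ := Real.exp (-(min κ δ₀ / 2)) with hq
  have hqpos : 0 < q := Real.exp_pos _
  have hqK : ∀ K : ℕ, q ^ K = Real.exp (-(min κ δ₀ * K / 2)) := fun K => by
    rw [hq, ← Real.exp_nat_mul]; ring_nf
  -- the rescaled tail and its rescaled summands
  set Δ : ℕ → ℝ := fun K => (∑ X ∈ Finset.univ.filter (fun X => ¬ lo K X), t K X) / q ^ K with hΔ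
  set a : (K : ℕ) → (domSys (F.P K) M j).Dom → ℝ := fun K X => if ¬ lo K X then t K X / q ^ K else 0 with ha
  have hΔa : ∀ K, Δ K ≤ ∑ X, a K X := fun K => by
    simp only [hΔ, ha, ← Finset.sum_filter, Finset.sum_div]
    exact le_rfl
  have hmaj : ∀ (K : ℕ) (X : (domSys (F.P K) M j).Dom),
      let e : Site (F.P K) j → TPt 4 (domCount (F.P K) M j * M) := fun x i => (ZMod.cast (x i) : ZMod (domCount (F.P K) M j * M))
      a K X ≤ CE * w * Real.exp (-(κ / 2) * torusTreeLen X.1) *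
          Real.exp (-(δ₀ / 2) * distCT (domCount (F.P K) M j) M (e (siteOfInt F K j z)) (nearT (M := M) (e (siteOfInt F K j z)) X)) *
          Real.exp (-(δ₀ / 2) * distCT (domCount (F.P K) M j) M (e (siteOfInt F K j 0)) (nearT (M := M) (e (siteOfInt F K j 0)) X)) := by
    intro K X e
    have hA : 0 ≤ CE * w := mul_nonneg hCE hw
    by_cases hX : lo K X
    · simp only [ha, hX, not_true_eq_false, if_false]
      positivity
    · simp only [ha, hX, not_false_eq_true, if_true]
      rw [div_le_iff₀ (pow_pos hqpos K), hqK K]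
      -- the threshold split on the two factors that can feel the volume
      set d := torusTreeLen X.1 with hd
      set Dz := distCT (domCount (F.P K) M j) M (e (siteOfInt F K j z)) (nearT (M := M) (e (siteOfInt F K j z)) X) with hDz
      set D0 := distCT (domCount (F.P K) M j) M (e (siteOfInt F K j 0)) (nearT (M := M) (e (siteOfInt F K j 0)) X) with hD0
      have hd0 : 0 ≤ d := torusTreeLen_nonneg _
      have hDz0 : 0 ≤ Dz := distCT_nonneg _ _
      have hD00 : 0 ≤ D0 := distCT_nonneg _ _
      have hsplit := exp_threshold_split (T := (K : ℝ)) hκ0.le hδ₀.le hd0 hD00 (hlo K X hX)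
      have hz : Real.exp (-(δ₀ * Dz)) ≤ Real.exp (-(δ₀ / 2 * Dz)) := Real.exp_le_exp.2 (by nlinarith)
      have htKX := ht K X
      simp only [neg_mul] at htKX ⊢
      calc t K X ≤ CE * w * Real.exp (-(κ * d)) * Real.exp (-(δ₀ * Dz)) * Real.exp (-(δ₀ * D0)) := htKX
        _ = CE * w * (Real.exp (-(κ * d)) * Real.exp (-(δ₀ * D0))) * Real.exp (-(δ₀ * Dz)) := by ring
        _ ≤ CE * w * (Real.exp (-(min κ δ₀ * K / 2)) * (Real.exp (-(κ / 2 * d)) * Real.exp (-(δ₀ / 2 * D0)))) * Real.exp (-(δ₀ / 2 * Dz)) :=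
            mul_le_mul (mul_le_mul_of_nonneg_left hsplit hA) hz (Real.exp_nonneg _) (by positivity)
        _ = CE * w * Real.exp (-(κ / 2 * d)) * Real.exp (-(δ₀ / 2 * Dz)) * Real.exp (-(δ₀ / 2 * D0)) * Real.exp (-(min κ δ₀ * K / 2)) := by ring
  have hev := eventually_le_of_softSum_domSys F j m' M hM Δ a hCE hw (half_pos hδ₀) hκ4 z hΔa hmaj
  obtain ⟨N₀, hN₀⟩ := Filter.eventually_atTop.1 hev
  refine ⟨N₀, CE * Real.exp (delta1 (δ₀ / 2) (κ / 2) ((M : ℝ) * 4) * ((M : ℝ) * 4) * 3) * K₀ (4 * 2 ^ 4) (2 * 4) * K₁ 4 (δ₀ / 2 / 2) * w *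
    Real.exp (-(delta1 (δ₀ / 2) (κ / 2) ((M : ℝ) * 4) * B12Sec2to5.l1 z)), ?_, fun K hK => ?_⟩
  · have := K₀_pos (4 * 2 ^ 4) (2 * 4)
    have := B12Decay510Window.K₁_nonneg 4 (δ₀ / 2 / 2)
    positivity
  · have h := hN₀ K hK
    rwa [hΔ, div_le_iff₀ (pow_pos hqpos K)] at h

end Tail

end YMDAG.N22.AtKernels

end
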